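import Mathlib.Analysis.Calculus.ContDiff.Bounds
import Mathlib.Analysis.Calculus.IteratedDeriv.Lemmas
import Mathlib.Analysis.Calculus.MeanValue
import Mathlib.Analysis.SpecialFunctions.Pow.Deriv
import Mathlib.Analysis.SpecialFunctions.Sqrt
import HarnessLib

/-!
# Flat functions composed with the square root (finite-order even-function lemma)

Support file for the proof of the Cohn–Kumar–Miller–Radchenko–Viazovska interpolation theorem
(`Literature/Analysis/Fourier/RadialSchwartzInterpolation.lean`). CKMRV (Ann. Math. 196 (2022),
proof of Lemma 2.2) write a compactly supported smooth radial function as `f(x) = g(|x|²)` with `g`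
smooth on `ℝ` — behind this is the classical fact that an even smooth function of `r` is a smooth
function of `r²` (Whitney 1943; CKMRV cite [GT] for their Lemma 2.1). We prove the finite-order
version that suffices for the interpolation theorem, in the form it is used: if `ρ : ℝ → F` is
smooth and **flat of order `4m + 6` at `0`** (all derivatives of order `< 4m + 6` vanish at `0`),
then `s ↦ ρ(√s)` (which vanishes for `s ≤ 0`) is `C^m` on `ℝ` (`contDiff_comp_sqrt_of_flat`).
Ingredients, all proved here: the iterated derivatives of `s ↦ s^{1/2}` on `(0, ∞)` and the bound
`|descPochhammer_k(1/2)| ≤ k!`; the flatness estimate `‖ρ⁽ʲ⁾(r)‖ ≤ M r^{2J−j}` on `[0,1]` (mean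
value theorem, downward induction); the Faà di Bruno bound
(`norm_iteratedFDerivWithin_comp_le`) giving `‖(ρ∘√)⁽ⁱ⁾(s)‖ ≤ K s^{J−2i}` on `(0,1]`; and the
gluing of the zero function on `s ≤ 0` with `ρ ∘ √` on `s > 0` derivative by derivative.

Everything is proved; no named facts, no new definitions.

## References

* H. Cohn, A. Kumar, S. D. Miller, D. Radchenko, M. Viazovska, *Universal optimality of the `E₈`
  and Leech lattices and interpolation formulas*, Ann. of Math. 196 (2022), §2.3 (Lemma 2.1 and
  the proof of Lemma 2.2). [CohnEtAl2019]
* H. Whitney, *Differentiable even functions*, Duke Math. J. 10 (1943) 159–160 (the `C^∞`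
  statement; not needed here). [folklore]
-/

noncomputable section

open scoped Topology ContDiff
open Filter Set Asymptotics

namespace Literature.Analysis.Fourier

variable {F : Type*} [NormedAddCommGroup F] [NormedSpace ℝ F]

/-! ## Iterated derivatives of `s ↦ s^{1/2}` on `(0, ∞)` -/

/-- `|descPochhammer_k(1/2)| = |(1/2)(1/2 − 1)⋯(1/2 − k + 1)| ≤ k!`. [folklore] -/
theorem abs_descPochhammer_eval_one_half_le (k : ℕ) :
    |(descPochhammer ℝ k).eval (1 / 2 : ℝ)| ≤ k.factorial := by
  induction k with
  | zero => simp
  | succ k ih =>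
      rw [descPochhammer_succ_right, Polynomial.eval_mul, abs_mul, Nat.factorial_succ, Nat.cast_mul,
        mul_comm ((k + 1 : ℕ) : ℝ)]
      refine mul_le_mul ih ?_ (abs_nonneg _) (Nat.cast_nonneg _)
      simp only [Polynomial.eval_sub, Polynomial.eval_X, Polynomial.eval_natCast]
      rw [abs_le]
      push_cast
      constructor <;> linarith

/-- The iterated derivatives of `s ↦ s^{1/2}` within `(0, ∞)`: `descPochhammer_k(1/2) s^{1/2 − k}`
(Mathlib's `Real.iter_deriv_rpow_const`, transported to `iteratedDerivWithin` on the open set).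
[folklore] -/
theorem iteratedDerivWithin_rpow_half {k : ℕ} {s : ℝ} (hs : 0 < s) :
    iteratedDerivWithin k (fun x : ℝ => x ^ (1 / 2 : ℝ)) (Ioi 0) s =
      (descPochhammer ℝ k).eval (1 / 2 : ℝ) * s ^ ((1 / 2 : ℝ) - k) := by
  rw [iteratedDerivWithin_of_isOpen isOpen_Ioi hs, iteratedDeriv_eq_iterate, Real.iter_deriv_rpow_const]

/-- Bound for the derivatives of `s^{1/2}` on `(0, 1]`: `‖(s^{1/2})⁽ᵏ⁾‖ ≤ k! s^{−k}` for `k ≥ 1`,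
hence `≤ (n!/s)ᵏ` for `1 ≤ k ≤ n`. [folklore] -/
theorem norm_iteratedDerivWithin_rpow_half_le {n k : ℕ} (hk : 1 ≤ k) (hkn : k ≤ n) {s : ℝ}
    (hs : 0 < s) (hs1 : s ≤ 1) :
    ‖iteratedDerivWithin k (fun x : ℝ => x ^ (1 / 2 : ℝ)) (Ioi 0) s‖ ≤ (n.factorial / s) ^ k := by
  rw [iteratedDerivWithin_rpow_half hs, norm_mul, Real.norm_eq_abs, Real.norm_eq_abs,
    abs_of_pos (Real.rpow_pos_of_pos hs _), div_pow]
  have h1 : |(descPochhammer ℝ k).eval (1 / 2 : ℝ)| ≤ (n.factorial : ℝ) ^ k := by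
    refine (abs_descPochhammer_eval_one_half_le k).trans ?_
    have hkf : (k.factorial : ℝ) ≤ n.factorial := by exact_mod_cast Nat.factorial_le hkn
    have hn1 : (1 : ℝ) ≤ n.factorial := by exact_mod_cast Nat.one_le_iff_ne_zero.2 (Nat.factorial_ne_zero n)
    calc (k.factorial : ℝ) ≤ n.factorial := hkf
      _ = (n.factorial : ℝ) ^ 1 := (pow_one _).symm
      _ ≤ (n.factorial : ℝ) ^ k := pow_le_pow_right₀ hn1 hk
  have h2 : s ^ ((1 / 2 : ℝ) - k) ≤ s ^ (-(k : ℝ)) :=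
    Real.rpow_le_rpow_of_exponent_ge hs hs1 (by linarith)
  have h3 : s ^ (-(k : ℝ)) = (s ^ k)⁻¹ := by
    rw [Real.rpow_neg hs.le, Real.rpow_natCast]
  calc |(descPochhammer ℝ k).eval (1 / 2 : ℝ)| * s ^ ((1 / 2 : ℝ) - k)
      ≤ (n.factorial : ℝ) ^ k * (s ^ k)⁻¹ := by
        rw [← h3]
        exact mul_le_mul h1 h2 (Real.rpow_nonneg hs.le _) (by positivity)
    _ = (n.factorial : ℝ) ^ k / s ^ k := by rw [div_eq_mul_inv]

/-! ## Flat functions: `‖ρ⁽ʲ⁾(r)‖ ≤ M r^{2J−j}` on `[0, 1]` -/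

/-- **Flatness estimate.** If `ρ` is `C^{L}` and `ρ⁽ʲ⁾(0) = 0` for all `j < L`, then with
`M = sup_{[0,1]} ‖ρ⁽ᴸ⁾‖` one has `‖ρ⁽ᴸ⁻ᵏ⁾(r)‖ ≤ M rᵏ` for `r ∈ [0,1]`, `k ≤ L` (mean value theorem,
induction on `k`). [folklore] -/
theorem norm_iteratedDeriv_le_of_flat {ρ : ℝ → F} {L : ℕ} (hρ : ContDiff ℝ L ρ)
    (hflat : ∀ j < L, iteratedDeriv j ρ 0 = 0) {M : ℝ}
    (hM : ∀ r ∈ Icc (0 : ℝ) 1, ‖iteratedDeriv L ρ r‖ ≤ M) :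
    ∀ k ≤ L, ∀ r ∈ Icc (0 : ℝ) 1, ‖iteratedDeriv (L - k) ρ r‖ ≤ M * r ^ k := by
  intro k
  induction k with
  | zero =>
      intro _ r hr
      simpa using hM r hr
  | succ k ih =>
      intro hk r hr
      have hk' : k ≤ L := Nat.le_of_succ_le hk
      set j := L - (k + 1) with hj
      have hjL : j < L := by omega
      have hj1 : j + 1 = L - k := by omega
      -- `ψ = ρ⁽ʲ⁾` has derivative `ρ⁽ʲ⁺¹⁾ = ρ⁽ᴸ⁻ᵏ⁾`
      have hdiff : Differentiable ℝ (iteratedDeriv j ρ) :=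
        hρ.differentiable_iteratedDeriv j (by exact_mod_cast hjL)
      have hderiv : ∀ u, HasDerivAt (iteratedDeriv j ρ) (iteratedDeriv (L - k) ρ u) u := fun u => by
        have h := (hdiff u).hasDerivAt
        rwa [← hj1, iteratedDeriv_succ]
      have hr0 : 0 ≤ r := hr.1
      have hbound : ∀ u ∈ Icc (0 : ℝ) r, ‖iteratedDeriv (L - k) ρ u‖ ≤ M * r ^ k := fun u hu => by
        have hu1 : u ∈ Icc (0 : ℝ) 1 := ⟨hu.1, hu.2.trans hr.2⟩
        refine (ih hk' u hu1).trans ?_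
        have hMnn : 0 ≤ M := le_trans (norm_nonneg _) (hM 0 ⟨le_rfl, zero_le_one⟩)
        exact mul_le_mul_of_nonneg_left (pow_le_pow_left₀ hu.1 hu.2 k) hMnn
      have hmvt := Convex.norm_image_sub_le_of_norm_hasDerivWithin_le
        (fun u _ => (hderiv u).hasDerivWithinAt) hbound (convex_Icc 0 r)
        (left_mem_Icc.2 hr0) (right_mem_Icc.2 hr0)
      rw [hflat j hjL, sub_zero, sub_zero, Real.norm_of_nonneg hr0] at hmvt
      calc ‖iteratedDeriv j ρ r‖ ≤ M * r ^ k * r := hmvt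
        _ = M * r ^ (k + 1) := by ring

/-- Flatness estimate, reindexed: `‖ρ⁽ʲ⁾(r)‖ ≤ M r^{L−j}` for `j ≤ L`, `r ∈ [0,1]`. [folklore] -/
theorem norm_iteratedDeriv_le_of_flat' {ρ : ℝ → F} {L : ℕ} (hρ : ContDiff ℝ L ρ)
    (hflat : ∀ j < L, iteratedDeriv j ρ 0 = 0) {M : ℝ}
    (hM : ∀ r ∈ Icc (0 : ℝ) 1, ‖iteratedDeriv L ρ r‖ ≤ M) {j : ℕ} (hj : j ≤ L) {r : ℝ}
    (hr : r ∈ Icc (0 : ℝ) 1) : ‖iteratedDeriv j ρ r‖ ≤ M * r ^ (L - j) := by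
  have h := norm_iteratedDeriv_le_of_flat hρ hflat hM (L - j) (Nat.sub_le L j) r hr
  rwa [Nat.sub_sub_self hj] at h

/-! ## The composition `s ↦ ρ(√s)` on `(0, 1]`: Faà di Bruno -/

/-- On `(0, ∞)`, `ρ ∘ √` is as smooth as `ρ`. [folklore] -/
theorem contDiffOn_comp_sqrt_Ioi {ρ : ℝ → F} {n : ℕ∞} (hρ : ContDiff ℝ n ρ) :
    ContDiffOn ℝ n (fun s : ℝ => ρ (Real.sqrt s)) (Ioi 0) := fun s hs =>
  (hρ.contDiffAt.comp s (Real.contDiffAt_sqrt (ne_of_gt hs))).contDiffWithinAt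

/-- **Decay of the derivatives of `ρ ∘ √` at `0⁺`.** If `ρ` is `C^{2J}` and flat of order `2J`
at `0`, with `M = sup_{[0,1]} ‖ρ⁽²ᴶ⁾‖`, then for `2i ≤ J` and `s ∈ (0, 1]`,
`‖(ρ∘√)⁽ⁱ⁾(s)‖ ≤ i! · M · (i!)ⁱ · s^{J − 2i}` (Faà di Bruno with `‖ρ⁽ʲ⁾(√s)‖ ≤ M s^{J−i}` for
`j ≤ i` and `‖(√·)⁽ʲ⁾(s)‖ ≤ (i!/s)ʲ`; the exponent is deliberately crude). [folklore] -/
theorem norm_iteratedDerivWithin_comp_sqrt_le {ρ : ℝ → F} {J : ℕ} (hρ : ContDiff ℝ (2 * J) ρ)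
    (hflat : ∀ j < 2 * J, iteratedDeriv j ρ 0 = 0) {M : ℝ}
    (hM : ∀ r ∈ Icc (0 : ℝ) 1, ‖iteratedDeriv (2 * J) ρ r‖ ≤ M) {i : ℕ} (hi : 2 * i ≤ J) {s : ℝ}
    (hs : 0 < s) (hs1 : s ≤ 1) :
    ‖iteratedDerivWithin i (fun s : ℝ => ρ (Real.sqrt s)) (Ioi 0) s‖ ≤
      i.factorial * M * (i.factorial : ℝ) ^ i * s ^ (J - 2 * i) := by
  have hMnn : 0 ≤ M := le_trans (norm_nonneg _) (hM 0 ⟨le_rfl, zero_le_one⟩)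
  have hsq : Real.sqrt s ∈ Icc (0 : ℝ) 1 := ⟨Real.sqrt_nonneg _, Real.sqrt_le_one.2 hs1⟩
  have hsqpos : 0 < Real.sqrt s := Real.sqrt_pos.2 hs
  -- work with `x ↦ x^{1/2}` on `(0, ∞)`
  have heq : EqOn (fun s : ℝ => ρ (Real.sqrt s)) (ρ ∘ fun x : ℝ => x ^ (1 / 2 : ℝ)) (Ioi 0) :=
    fun x _ => by simp [Real.sqrt_eq_rpow]
  rw [iteratedDerivWithin_congr heq hs]
  -- Faà di Bruno
  have hg : ContDiffOn ℝ (2 * J : ℕ) ρ univ := hρ.contDiffOn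
  have hf : ContDiffOn ℝ (2 * J : ℕ) (fun x : ℝ => x ^ (1 / 2 : ℝ)) (Ioi 0) := fun x hx =>
    (Real.contDiffAt_rpow_const_of_ne (p := 1 / 2) (ne_of_gt hx)).contDiffWithinAt
  have hC : ∀ j, j ≤ i → ‖iteratedFDerivWithin ℝ j ρ univ ((fun x : ℝ => x ^ (1 / 2 : ℝ)) s)‖ ≤
      M * s ^ (J - i) := by
    intro j hj
    rw [iteratedFDerivWithin_univ, norm_iteratedFDeriv_eq_norm_iteratedDeriv]
    have hjL : j ≤ 2 * J := by omega
    have h := norm_iteratedDeriv_le_of_flat' hρ hflat hM hjL (r := s ^ (1 / 2 : ℝ))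
      (by rw [← Real.sqrt_eq_rpow]; exact hsq)
    refine h.trans (mul_le_mul_of_nonneg_left ?_ hMnn)
    -- `(s^{1/2})^{2J-j} ≤ (s^{1/2})^{2(J-i)} = s^{J-i}` as `s^{1/2} ≤ 1` and `2(J-i) ≤ 2J-j`
    have hle1 : s ^ (1 / 2 : ℝ) ≤ 1 := by rw [← Real.sqrt_eq_rpow]; exact hsq.2
    have hnn : 0 ≤ s ^ (1 / 2 : ℝ) := Real.rpow_nonneg hs.le _
    calc (s ^ (1 / 2 : ℝ)) ^ (2 * J - j) ≤ (s ^ (1 / 2 : ℝ)) ^ (2 * (J - i)) :=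
          pow_le_pow_of_le_one hnn hle1 (by omega)
      _ = s ^ (J - i) := by
          rw [pow_mul, ← Real.rpow_natCast (s ^ (1 / 2 : ℝ)) 2, ← Real.rpow_mul hs.le]
          norm_num
  have hD : ∀ j, 1 ≤ j → j ≤ i →
      ‖iteratedFDerivWithin ℝ j (fun x : ℝ => x ^ (1 / 2 : ℝ)) (Ioi 0) s‖ ≤ (i.factorial / s) ^ j := by
    intro j hj1 hji
    rw [norm_iteratedFDerivWithin_eq_norm_iteratedDerivWithin]
    exact norm_iteratedDerivWithin_rpow_half_le hj1 hji hs hs1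
  have hmain := norm_iteratedFDerivWithin_comp_le hg hf (by exact_mod_cast (by omega : i ≤ 2 * J))
    uniqueDiffOn_univ (uniqueDiffOn_Ioi 0) (fun x _ => mem_univ _) hs hC hD
  rw [norm_iteratedFDerivWithin_eq_norm_iteratedDerivWithin] at hmain
  refine hmain.trans (le_of_eq ?_)
  rw [div_pow]
  have hsi : s ^ (J - i) = s ^ (J - 2 * i) * s ^ i := by
    rw [← pow_add]; congr 1; omega
  rw [hsi]
  field_simp

/-! ## Gluing with the zero function: `s ↦ ρ(√s)` is `C^m` -/

/-- **Finite-order even-function lemma (flat case).** Let `ρ : ℝ → F` be smooth with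
`ρ⁽ʲ⁾(0) = 0` for all `j < 4m + 4`. Then `s ↦ ρ(√s)` — which equals `ρ(0) = 0` for `s ≤ 0` — is
`C^m` on `ℝ`. (Used, after subtracting an even Taylor polynomial, to write a compactly supported
smooth radial function as `g(|x|²)` with `g ∈ C^m_c(ℝ)`, the finite-order form of the device in the
proof of CKMRV Lemma 2.2 / Lemma 2.1.) [folklore] -/
theorem contDiff_comp_sqrt_of_flat {ρ : ℝ → F} (hρ : ContDiff ℝ ∞ ρ) (m : ℕ)
    (hflat : ∀ j < 4 * m + 4, iteratedDeriv j ρ 0 = 0) :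
    ContDiff ℝ m (fun s : ℝ => ρ (Real.sqrt s)) := by
  set J : ℕ := 2 * m + 2 with hJ
  have h2J : 2 * J = 4 * m + 4 := by omega
  have hρJ : ContDiff ℝ (2 * J) ρ := contDiff_infty.1 hρ (2 * J)
  have hflatJ : ∀ j < 2 * J, iteratedDeriv j ρ 0 = 0 := fun j hj => hflat j (by omega)
  -- a bound for `ρ⁽²ᴶ⁾` on `[0,1]`
  obtain ⟨M, hM⟩ : ∃ M, ∀ r ∈ Icc (0 : ℝ) 1, ‖iteratedDeriv (2 * J) ρ r‖ ≤ M :=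
    isCompact_Icc.exists_bound_of_continuousOn
      ((hρJ.continuous_iteratedDeriv (2 * J) le_rfl).continuousOn)
  have hMnn : 0 ≤ M := le_trans (norm_nonneg _) (hM 0 ⟨le_rfl, zero_le_one⟩)
  set h : ℝ → F := fun s => ρ (Real.sqrt s) with hh
  have hρ0 : ρ 0 = 0 := by simpa using hflat 0 (by omega)
  have hh0 : ∀ s, s ≤ 0 → h s = 0 := fun s hs => by
    simp only [hh, Real.sqrt_eq_zero'.2 hs, hρ0]
  -- smoothness on `(0, ∞)`
  have hN : ContDiffOn ℝ (2 * J : ℕ) h (Ioi 0) := contDiffOn_comp_sqrt_Ioi (n := (2 * J : ℕ)) (by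
    exact_mod_cast hρJ)
  -- the candidate derivatives
  set D : ℕ → ℝ → F := fun i s => if 0 < s then iteratedDerivWithin i h (Ioi 0) s else 0 with hD
  -- decay of `D i` at `0⁺`
  have hdecay : ∀ i ≤ m, ∀ u ∈ Ioc (0 : ℝ) 1,
      ‖iteratedDerivWithin i h (Ioi 0) u‖ ≤ (i.factorial * M * (i.factorial : ℝ) ^ i) * u ^ 2 := by
    intro i hi u hu
    have h1 := norm_iteratedDerivWithin_comp_sqrt_le hρJ hflatJ hM (i := i) (by omega) hu.1 hu.2
    refine h1.trans ?_
    have : u ^ (J - 2 * i) ≤ u ^ 2 := pow_le_pow_of_le_one hu.1.le hu.2 (by omega)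
    exact mul_le_mul_of_nonneg_left this (by positivity)
  -- the key step: `D i` has derivative `D (i+1)` everywhere, for `i ≤ m`
  have hderiv : ∀ i ≤ m, ∀ s, HasDerivAt (D i) (D (i + 1) s) s := by
    intro i hi s
    rcases lt_trichotomy s 0 with hs | hs | hs
    · -- `s < 0`: locally zero
      have hev : D i =ᶠ[𝓝 s] fun _ => (0 : F) := by
        filter_upwards [Iio_mem_nhds hs] with u hu
        simp only [hD, if_neg (not_lt.2 (mem_Iio.1 hu).le)]
      have : D (i + 1) s = 0 := by simp only [hD, if_neg (not_lt.2 hs.le)]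
      rw [this]
      exact (hasDerivAt_const s (0 : F)).congr_of_eventuallyEq hev
    · -- `s = 0`: squeeze
      subst hs
      have hD0 : D (i + 1) 0 = 0 := by simp only [hD, if_neg (lt_irrefl _)]
      have hDi0 : D i 0 = 0 := by simp only [hD, if_neg (lt_irrefl _)]
      rw [hD0, hasDerivAt_iff_isLittleO_nhds_zero]
      simp only [zero_add, hDi0, sub_zero, smul_zero]
      have hbig : (fun u : ℝ => D i u) =O[𝓝 0] fun u : ℝ => u ^ 2 := by
        refine IsBigO.of_bound (i.factorial * M * (i.factorial : ℝ) ^ i) ?_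
        filter_upwards [Ioo_mem_nhds (show (-1 : ℝ) < 0 by norm_num) (show (0 : ℝ) < 1 by norm_num)]
          with u hu
        by_cases hu0 : 0 < u
        · simp only [hD, if_pos hu0]
          rw [Real.norm_eq_abs, abs_of_nonneg (sq_nonneg u)]
          exact hdecay i hi u ⟨hu0, hu.2.le⟩
        · simp only [hD, if_neg hu0, norm_zero]
          positivity
      exact hbig.trans_isLittleO (isLittleO_pow_id one_lt_two)
    · -- `s > 0`: the derivative within `(0, ∞)`
      have hev : D i =ᶠ[𝓝 s] iteratedDerivWithin i h (Ioi 0) := by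
        filter_upwards [Ioi_mem_nhds hs] with u hu
        simp only [hD, if_pos (mem_Ioi.1 hu)]
      have hdiffW : DifferentiableWithinAt ℝ (iteratedDerivWithin i h (Ioi 0)) (Ioi 0) s :=
        hN.differentiableOn_iteratedDerivWithin (by exact_mod_cast (by omega : i < 2 * J))
          (uniqueDiffOn_Ioi 0) s hs
      have hdiff : DifferentiableAt ℝ (iteratedDerivWithin i h (Ioi 0)) s :=
        hdiffW.differentiableAt (Ioi_mem_nhds hs)
      have hval : D (i + 1) s = deriv (iteratedDerivWithin i h (Ioi 0)) s := by
        simp only [hD, if_pos hs]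
        rw [iteratedDerivWithin_succ, derivWithin_of_isOpen isOpen_Ioi hs]
      rw [hval]
      exact hdiff.hasDerivAt.congr_of_eventuallyEq hev
  -- identification of the iterated derivatives
  have hiter : ∀ i ≤ m + 1, iteratedDeriv i h = D i := by
    intro i
    induction i with
    | zero =>
        intro _
        funext s
        by_cases hs : 0 < s
        · simp only [iteratedDeriv_zero, hD, if_pos hs, iteratedDerivWithin_zero]
        · simp only [iteratedDeriv_zero, hD, if_neg hs, hh0 s (not_lt.1 hs)]
    | succ i ih =>
        intro hi
        rw [iteratedDeriv_succ, ih (by omega)]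
        funext s
        exact (hderiv i (by omega) s).deriv
  -- conclusion
  refine contDiff_of_differentiable_iteratedDeriv fun i hi => ?_
  have him : i ≤ m := by exact_mod_cast hi
  rw [hiter i (by omega)]
  exact fun s => (hderiv i him s).differentiableAt

omit [NormedSpace ℝ F] in
/-- The support of `s ↦ ρ(√s)`: if `ρ(r) = 0` for `r ≥ R` (`R ≥ 0`) then `ρ(√s) = 0` for
`s ≥ R²`. [folklore] -/
theorem comp_sqrt_eq_zero_of_le {ρ : ℝ → F} {R : ℝ} (hR : 0 ≤ R) (hρ : ∀ r, R ≤ r → ρ r = 0)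
    {s : ℝ} (hs : R ^ 2 ≤ s) : ρ (Real.sqrt s) = 0 :=
  hρ _ (by rw [← Real.sqrt_sq hR]; exact Real.sqrt_le_sqrt hs)

end Literature.Analysis.Fourier
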